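import Summits.QuantumFields.QCD.Theses.HeatSlicedQuarks
import Summits.QuantumFields.QCD.Theorems.HeatSlicedQuarksRobustYangMillsHandoverSplit

/-!
# Line `glimm-jaffe-continuation` — ALTERNATIVE skeleton (strategist cstrat-stmt-QuantumFields-8892-s2, gen 1, 2026-08-17)

Crux `stmt-QuantumFields-8892`,
`Summit.QuantumFields.QCD.Theses.HeatSlicedQuarks.RobustYangMillsHandover := ContinuumQCDExists → QCD`
(re-typed conjunct: `QCDOf N_f` conjoins `reg.IsChiralAtZero`, p117723).

## What this line is (and is not)

An ALTERNATIVE line registered additively (`stub-add`; it does NOT replace the lead's `pin_the_infimum` skeleton).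
Frame = the strategist-s1 R1 decomposition whose glue is LANDED (p140732,
`Theorems/HeatSlicedQuarksRobustYangMillsHandoverSplit.lean`): child 1 `HeavyThresholdHandover`, child 2
`GaplessPointOnMassAxis` (stubs 1–2, signatures byte-identical with s1's `children.json` and with the landed glue's
hypotheses), and child 3 `GappedMassContinuation` CUT HERE, inside the skeleton, along the two engines of its solved
sibling — the φ⁴ critical point, Glimm–Jaffe, *Quantum Physics* (2nd ed. 1987) §17.5–17.6 (after Baker 1975,
McBryan–Rosen CMP 51 (1976) 97, J. Rosen 1980), where `σ_c := inf {σ : unique phase ∧ exponential decay}` is literally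
the infimum pin of the landed glue (`exists_pin_of_threshold_gapless_continuation`):

* `stub_anchoredGapContinuation` (3a, LATTICE ONLY; sibling = GJ Thm 17.5.1 "the mass m(σ) is continuous in σ",
  proved by showing that a power `m̃^{2α+1}` of a volume-uniform PSEUDOMASS envelope is Lipschitz in σ: differentiate in
  σ (Feynman–Hellmann; here item 8909 `QuarkMassMonotone.MassDerivativeIdentity`), bound the `:φ²:`-inserted truncated
  three-point function by products of two-point functions (LEBOWITZ inequality — the one step lattice QCD lacks; its
  replacement is a volume-uniform sigma-term bound on the `ψ̄ψ`-inserted three-point function of the pair, i.e. the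
  content of the lead's `stub_sigmaTermBound`, but at CORRELATOR level: no transfer-matrix dictionary M1/M2/M4/M5 is
  needed, because `HasLatticeMassGap` and the pseudomass are both per-pair), then continuous induction (the landed
  barrier lemma p143392).  Statement: for an honest regularisation (full body above `M`), a uniform lattice rate `ε`
  above the offset `M` continues to the rate `ε/2` above `M − δ(ε)`, `δ` uniform in `M`.  GMOR (`m_π² ≈ 2Bm`) says
  the Lipschitz quantity is the SQUARED gap, `δ(ε) ≈ 3ε²/(8B̄)`; a uniform Lipschitz modulus for the gap itself is false.
  The honesty hypothesis is load-bearing: without it a fixed-β regularisation parked on a first-order point of the bare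
  mass axis refutes the bare lattice statement (STRATEGY-CENSUS.md §Negation).
* `stub_anchoredDataContinuation` (3b, EXISTENCE; sibling = GJ §17.6 "weak coupling boundary conditions": Schwinger
  functions for all `σ ≥ σ_c` as Griffiths-II MONOTONE limits from the cluster-expansion region): from the full body above
  `M` and a uniform lattice rate `ε/2` above `M − δ`, the full body (continuum data with E0–E4, non-triviality,
  non-decoupling, continuum + lattice gap) above `M − δ'` for some `0 < δ' ≤ δ` depending on `(reg, ε, δ)` only.
  Lattice QCD has no monotonicity of general correlators in the quark mass, and E1/E4 of `OSData` plus FULL-sequence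
  convergence (`IsQCDAlong`) do not pass through equicontinuity/compactness, so this stub needs identity-theorem-grade
  regularity in the complexified offset (Lee–Yang zero-freeness of the Wilson-QCD partition function with sources near
  the positive mass axis, uniformly in `(k, S)`, + Vitali; two-constants p124094 / biaffine p124742 / LeeYangCertificate
  p124594 are landed atoms) or a UV re-construction below the offset (`EulerDescent.RetypedContinuumComplement`, 16903).
  The existence-extension debt is GENERIC for `X₀ → QCD` (an honest X₀ witness places its zero offset at or above the
  chiral point, generically strictly above — FINDINGS-r2k4 A4), so 3b cannot be typed away inside this route.

`gappedMassContinuation_of : stub_3a → stub_3b → child 3` is proved below (sorry-free), and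
`RobustYangMillsHandover_of` concludes the crux BY NAME through the landed `Split.RobustYangMillsHandover_of_subs`.
Sorries ONLY inside the four `stub_*`.

## Why it dodges the STUCK goals of the registered lines

* The live line `pin_the_infimum` (lead c14, gen 3) is stuck on `stub_spectralDictionary` = infrastructure M1 (Lüscher
  trace formula with quark insertions) + M2 (min–max = spectrum on `L²(SU(3)^E; Fock)`) + M4 (pair-uniformity, physics)
  + M5 (`(−1)^F` wrap-around), all needed only because its response stub lives at TRANSFER-MATRIX level
  (`transferGapAt`).  The Glimm–Jaffe pseudomass runs the same Lipschitz/barrier mechanism on the CORRELATORS of one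
  pair at a time — the level at which `HasLatticeMassGap` is stated — so 3a needs no dictionary; M1/M2/M5 leave the
  critical path and M4 disappears (per-pair in, per-pair out; `δ(ε)` is pair-uniform because the sigma-term constant is).
* Round 2 died at `stub_pinnedData` / at-the-pin chirality suppliers; as in s1's frame, data below an anchor come from
  CONTINUATION (3b) and the pin is DERIVED by the landed order-theoretic glue.
* Round 1 (`StuckGoalC4`, chirality of an arbitrary `m_crit` shift) is not re-entered: nothing here shifts inside a
  uniformly gapped half-line (`Negative.ChiralityObstruction.not_isChiralAtZero_mcrit_shift_of_uniformGapAbove`).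
* Disproof.lean (cycles 1–3, `-- Targets: none`, no `_false_without_` theorem): §2 non-triviality is used in stubs 1, 2
  and in the honesty hypothesis of 3a (which is what excludes the first-order junk regularisations); §6 scheme-independence
  of `HasLatticeMassGap` (all gap clauses read `reg.scheme m 0 0`); §13 (G4) is confined to 3b's lattice→continuum gap
  transfer; landed Negative lemmas `WithoutNontriviality`, `GapClauses`, `SchemeAsymptotics`, `HoppingWindow`,
  `FreeWilsonModes`, `ChiralityObstruction` — none instantiated by a stub (no stub asserts a uniform rate above a pin,
  expands in κ, or inverts the fine Dirac operator).
-/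

namespace Summit.QuantumFields.QCD.Cruxes.RobustYangMillsHandover.GlimmJaffeContinuation

open Summit.QuantumFields.QCD.Theses.HeatSlicedQuarks
open Literature.MathematicalPhysics.QuantumFieldTheory

/-! ## §1 The four registered stubs -/

/-- **stub_heavyThresholdHandover — child 1, HEAVY-THRESHOLD HANDOVER** (`X₀ → ThresholdQCD`; the pre-re-type crux;
signature byte-identical with s1's child 1 and the landed glue's first hypothesis).  Contains robust SU(3) Yang–Mills +
heavy-quark decoupling; every round-1 line of the crux is a line for it.  Size: crux. -/
theorem stub_heavyThresholdHandover :
    ContinuumQCDExists → ∀ Nf : ℕ, Nf = 2 ∨ Nf = 3 → ∃ M₀ : ℝ, 0 ≤ M₀ ∧ ∃ reg : Literature.MathematicalPhysics.QuantumFieldTheory.QCDRegularisation Nf, reg.HasMassScaling ∧ ∀ m : Fin Nf → ℝ, (∀ f, M₀ < m f) → ∃ (z shift : Literature.MathematicalPhysics.QuantumFieldTheory.QCDField Nf → ℕ → ℝ) (T : Literature.MathematicalPhysics.QuantumFieldTheory.OSData (Literature.MathematicalPhysics.QuantumFieldTheory.QCDField Nf) 4), Literature.MathematicalPhysics.QuantumFieldTheory.IsQCDAlong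 (reg.scheme m z shift) T ∧ T.IsNontrivial Literature.MathematicalPhysics.QuantumFieldTheory.QCDField.glue ∧ T.IsNonGaussian Literature.MathematicalPhysics.QuantumFieldTheory.QCDField.glue ∧ (∀ f g : Fin Nf, f ≠ g → T.IsNontrivial (Literature.MathematicalPhysics.QuantumFieldTheory.QCDField.pseudoRe f g)) ∧ ∃ Δ > 0, T.HasMassGap Δ ∧ (reg.scheme m z shift).HasLatticeMassGap Δ := by
  sorry

/-- **stub_gaplessPointOnMassAxis — child 2, A GAPLESS POINT ON THE MASS AXIS** (Goldstone / anomaly-matching input; signature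
byte-identical with s1's child 2).  Size: crux. -/
theorem stub_gaplessPointOnMassAxis :
    ∀ Nf : ℕ, Nf = 2 ∨ Nf = 3 → ∀ reg : Literature.MathematicalPhysics.QuantumFieldTheory.QCDRegularisation Nf, reg.HasMassScaling → (∃ M₀ : ℝ, ∀ m : Fin Nf → ℝ, (∀ f, M₀ < m f) → ∃ (z shift : Literature.MathematicalPhysics.QuantumFieldTheory.QCDField Nf → ℕ → ℝ) (T : Literature.MathematicalPhysics.QuantumFieldTheory.OSData (Literature.MathematicalPhysics.QuantumFieldTheory.QCDField Nf) 4), Literature.MathematicalPhysics.QuantumFieldTheory.IsQCDAlong (reg.scheme m z shift) T ∧ T.IsNontrivial Literature.MathematicalPhysics.QuantumFieldTheory.QCDField.glue ∧ T.IsNonGaussian Literature.MathematicalPhysics.QuantumFieldTheory.QCDField.glue ∧ (∀ f g : Fin Nf, f ≠ g → T.IsNontrivial (Literature.MathematicalPhysics.QuantumFieldTheory.QCDField.pseudoRe f g)) ∧ ∃ Δ > 0, T.HasMassGap Δ ∧ (reg.scheme m z shift).HasLatticeMassGap Δ) → ∃ M : ℝ, ∀ ε : ℝ, 0 < ε → ∃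 m : Fin Nf → ℝ, (∀ f, M < m f) ∧ ¬ (reg.scheme m 0 0).HasLatticeMassGap ε := by
  sorry

/-- **stub_anchoredGapContinuation — 3a, LATTICE GAP CONTINUATION below a uniformly gapped, honest anchor**
(Glimm–Jaffe Thm 17.5.1 analogue: pseudomass envelope, Feynman–Hellmann 8909, sigma-term bound in place of Lebowitz,
continuous induction p143392): `∀ ε ∃ δ ∀ M`, body above `M` ∧ lattice rate `ε` above `M` ⇒ lattice rate `ε/2` above
`M − δ`.  Lattice-level, per-pair; no continuum data in the conclusion.  Size: L–XL (the volume-uniform sigma-term bound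
is open physics; everything else is finite-dimensional calculus). -/
theorem stub_anchoredGapContinuation :
    ∀ Nf : ℕ, Nf = 2 ∨ Nf = 3 → ∀ reg : Literature.MathematicalPhysics.QuantumFieldTheory.QCDRegularisation Nf, reg.HasMassScaling → ∀ ε : ℝ, 0 < ε → ∃ δ : ℝ, 0 < δ ∧ ∀ M : ℝ, (∀ m : Fin Nf → ℝ, (∀ f, M < m f) → ∃ (z shift : Literature.MathematicalPhysics.QuantumFieldTheory.QCDField Nf → ℕ → ℝ) (T : Literature.MathematicalPhysics.QuantumFieldTheory.OSData (Literature.MathematicalPhysics.QuantumFieldTheory.QCDField Nf) 4), Literature.MathematicalPhysics.QuantumFieldTheory.IsQCDAlong (reg.scheme m z shift) T ∧ T.IsNontrivial Literature.MathematicalPhysics.QuantumFieldTheory.QCDField.glue ∧ T.IsNonGaussian Literature.MathematicalPhysics.QuantumFieldTheory.QCDField.glue ∧ (∀ f g : Fin Nf, f ≠ g → T.IsNontrivial (Literature.MathematicalPhysics.QuantumFieldTheory.QCDField.pseudoRe f g)) ∧ ∃ Δ > 0, T.HasMassGap Δ ∧ (reg.scheme m z shift).HasLatticeMassGap Δ)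 → (∀ m : Fin Nf → ℝ, (∀ f, M < m f) → (reg.scheme m 0 0).HasLatticeMassGap ε) → ∀ m : Fin Nf → ℝ, (∀ f, M - δ < m f) → (reg.scheme m 0 0).HasLatticeMassGap (ε / 2) := by
  sorry

/-- **stub_anchoredDataContinuation — 3b, CONTINUUM DATA CONTINUATION from a uniformly lattice-gapped anchor**
(Glimm–Jaffe §17.6 analogue; here by Lee–Yang/Vitali analyticity in the complexified offset or UV re-construction 16903):
`∀ ε ∀ δ ∃ δ' ≤ δ ∀ M`, body above `M` ∧ lattice rate `ε/2` above `M − δ` ⇒ body above `M − δ'`.  Size: crux (the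
generic existence-extension debt of `X₀ → QCD`). -/
theorem stub_anchoredDataContinuation :
    ∀ Nf : ℕ, Nf = 2 ∨ Nf = 3 → ∀ reg : Literature.MathematicalPhysics.QuantumFieldTheory.QCDRegularisation Nf, reg.HasMassScaling → ∀ ε : ℝ, 0 < ε → ∀ δ : ℝ, 0 < δ → ∃ δ' : ℝ, 0 < δ' ∧ δ' ≤ δ ∧ ∀ M : ℝ, (∀ m : Fin Nf → ℝ, (∀ f, M < m f) → ∃ (z shift : Literature.MathematicalPhysics.QuantumFieldTheory.QCDField Nf → ℕ → ℝ) (T : Literature.MathematicalPhysics.QuantumFieldTheory.OSData (Literature.MathematicalPhysics.QuantumFieldTheory.QCDField Nf) 4), Literature.MathematicalPhysics.QuantumFieldTheory.IsQCDAlong (reg.scheme m z shift) T ∧ T.IsNontrivial Literature.MathematicalPhysics.QuantumFieldTheory.QCDField.glue ∧ T.IsNonGaussian Literature.MathematicalPhysics.QuantumFieldTheory.QCDField.glue ∧ (∀ f g : Fin Nf, f ≠ g → T.IsNontrivial (Literature.MathematicalPhysics.QuantumFieldTheory.QCDField.pseudoRe f g)) ∧ ∃ Δ > 0, T.HasMassGap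 Δ ∧ (reg.scheme m z shift).HasLatticeMassGap Δ) → (∀ m : Fin Nf → ℝ, (∀ f, M - δ < m f) → (reg.scheme m 0 0).HasLatticeMassGap (ε / 2)) → ∀ m : Fin Nf → ℝ, (∀ f, M - δ' < m f) → ∃ (z shift : Literature.MathematicalPhysics.QuantumFieldTheory.QCDField Nf → ℕ → ℝ) (T : Literature.MathematicalPhysics.QuantumFieldTheory.OSData (Literature.MathematicalPhysics.QuantumFieldTheory.QCDField Nf) 4), Literature.MathematicalPhysics.QuantumFieldTheory.IsQCDAlong (reg.scheme m z shift) T ∧ T.IsNontrivial Literature.MathematicalPhysics.QuantumFieldTheory.QCDField.glue ∧ T.IsNonGaussian Literature.MathematicalPhysics.QuantumFieldTheory.QCDField.glue ∧ (∀ f g : Fin Nf, f ≠ g → T.IsNontrivial (Literature.MathematicalPhysics.QuantumFieldTheory.QCDField.pseudoRe f g)) ∧ ∃ Δ > 0, T.HasMassGap Δ ∧ (reg.scheme m z shift).HasLatticeMassGap Δ := by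
  sorry

/-! ## §2 Child 3 from 3a + 3b (sorry-free) -/

/-- **`GappedMassContinuation` (s1's child 3, byte-identical) from the two anchored continuations.** [folklore] -/
theorem gappedMassContinuation_of
    (h3a : ∀ Nf : ℕ, Nf = 2 ∨ Nf = 3 → ∀ reg : Literature.MathematicalPhysics.QuantumFieldTheory.QCDRegularisation Nf, reg.HasMassScaling → ∀ ε : ℝ, 0 < ε → ∃ δ : ℝ, 0 < δ ∧ ∀ M : ℝ, (∀ m : Fin Nf → ℝ, (∀ f, M < m f) → ∃ (z shift : Literature.MathematicalPhysics.QuantumFieldTheory.QCDField Nf → ℕ → ℝ) (T : Literature.MathematicalPhysics.QuantumFieldTheory.OSData (Literature.MathematicalPhysics.QuantumFieldTheory.QCDField Nf) 4), Literature.MathematicalPhysics.QuantumFieldTheory.IsQCDAlong (reg.scheme m z shift) T ∧ T.IsNontrivial Literature.MathematicalPhysics.QuantumFieldTheory.QCDField.glue ∧ T.IsNonGaussian Literature.MathematicalPhysics.QuantumFieldTheory.QCDField.glue ∧ (∀ f g : Fin Nf, f ≠ g → T.IsNontrivial (Literature.MathematicalPhysics.QuantumFieldTheory.QCDField.pseudoRe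 f g)) ∧ ∃ Δ > 0, T.HasMassGap Δ ∧ (reg.scheme m z shift).HasLatticeMassGap Δ) → (∀ m : Fin Nf → ℝ, (∀ f, M < m f) → (reg.scheme m 0 0).HasLatticeMassGap ε) → ∀ m : Fin Nf → ℝ, (∀ f, M - δ < m f) → (reg.scheme m 0 0).HasLatticeMassGap (ε / 2))
    (h3b : ∀ Nf : ℕ, Nf = 2 ∨ Nf = 3 → ∀ reg : Literature.MathematicalPhysics.QuantumFieldTheory.QCDRegularisation Nf, reg.HasMassScaling → ∀ ε : ℝ, 0 < ε → ∀ δ : ℝ, 0 < δ → ∃ δ' : ℝ, 0 < δ' ∧ δ' ≤ δ ∧ ∀ M : ℝ, (∀ m : Fin Nf → ℝ, (∀ f, M < m f) → ∃ (z shift : Literature.MathematicalPhysics.QuantumFieldTheory.QCDField Nf → ℕ → ℝ) (T : Literature.MathematicalPhysics.QuantumFieldTheory.OSData (Literature.MathematicalPhysics.QuantumFieldTheory.QCDField Nf) 4), Literature.MathematicalPhysics.QuantumFieldTheory.IsQCDAlong (reg.scheme m z shift) T ∧ T.IsNontrivial Literature.MathematicalPhysics.QuantumFieldTheory.QCDField.glue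 ∧ T.IsNonGaussian Literature.MathematicalPhysics.QuantumFieldTheory.QCDField.glue ∧ (∀ f g : Fin Nf, f ≠ g → T.IsNontrivial (Literature.MathematicalPhysics.QuantumFieldTheory.QCDField.pseudoRe f g)) ∧ ∃ Δ > 0, T.HasMassGap Δ ∧ (reg.scheme m z shift).HasLatticeMassGap Δ) → (∀ m : Fin Nf → ℝ, (∀ f, M - δ < m f) → (reg.scheme m 0 0).HasLatticeMassGap (ε / 2)) → ∀ m : Fin Nf → ℝ, (∀ f, M - δ' < m f) → ∃ (z shift : Literature.MathematicalPhysics.QuantumFieldTheory.QCDField Nf → ℕ → ℝ) (T : Literature.MathematicalPhysics.QuantumFieldTheory.OSData (Literature.MathematicalPhysics.QuantumFieldTheory.QCDField Nf) 4), Literature.MathematicalPhysics.QuantumFieldTheory.IsQCDAlong (reg.scheme m z shift) T ∧ T.IsNontrivial Literature.MathematicalPhysics.QuantumFieldTheory.QCDField.glue ∧ T.IsNonGaussian Literature.MathematicalPhysics.QuantumFieldTheory.QCDField.glue ∧ (∀ f g : Fin Nf, f ≠ g → T.IsNontrivial (Literature.MathematicalPhysics.QuantumFieldTheory.QCDField.pseudoRe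 f g)) ∧ ∃ Δ > 0, T.HasMassGap Δ ∧ (reg.scheme m z shift).HasLatticeMassGap Δ) :
    ∀ Nf : ℕ, Nf = 2 ∨ Nf = 3 → ∀ reg : Literature.MathematicalPhysics.QuantumFieldTheory.QCDRegularisation Nf, reg.HasMassScaling → ∀ ε : ℝ, 0 < ε → ∃ δ : ℝ, 0 < δ ∧ ∀ M : ℝ, (∀ m : Fin Nf → ℝ, (∀ f, M < m f) → (reg.scheme m 0 0).HasLatticeMassGap ε) → (∀ m : Fin Nf → ℝ, (∀ f, M < m f) → ∃ (z shift : Literature.MathematicalPhysics.QuantumFieldTheory.QCDField Nf → ℕ → ℝ) (T : Literature.MathematicalPhysics.QuantumFieldTheory.OSData (Literature.MathematicalPhysics.QuantumFieldTheory.QCDField Nf) 4), Literature.MathematicalPhysics.QuantumFieldTheory.IsQCDAlong (reg.scheme m z shift) T ∧ T.IsNontrivial Literature.MathematicalPhysics.QuantumFieldTheory.QCDField.glue ∧ T.IsNonGaussian Literature.MathematicalPhysics.QuantumFieldTheory.QCDField.glue ∧ (∀ f g : Fin Nf, f ≠ g → T.IsNontrivial (Literature.MathematicalPhysics.QuantumFieldTheory.QCDField.pseudoRe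 f g)) ∧ ∃ Δ > 0, T.HasMassGap Δ ∧ (reg.scheme m z shift).HasLatticeMassGap Δ) → ∀ m : Fin Nf → ℝ, (∀ f, M - δ < m f) → ∃ (z shift : Literature.MathematicalPhysics.QuantumFieldTheory.QCDField Nf → ℕ → ℝ) (T : Literature.MathematicalPhysics.QuantumFieldTheory.OSData (Literature.MathematicalPhysics.QuantumFieldTheory.QCDField Nf) 4), Literature.MathematicalPhysics.QuantumFieldTheory.IsQCDAlong (reg.scheme m z shift) T ∧ T.IsNontrivial Literature.MathematicalPhysics.QuantumFieldTheory.QCDField.glue ∧ T.IsNonGaussian Literature.MathematicalPhysics.QuantumFieldTheory.QCDField.glue ∧ (∀ f g : Fin Nf, f ≠ g → T.IsNontrivial (Literature.MathematicalPhysics.QuantumFieldTheory.QCDField.pseudoRe f g)) ∧ ∃ Δ > 0, T.HasMassGap Δ ∧ (reg.scheme m z shift).HasLatticeMassGap Δ := by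
  intro Nf hNf reg hMS ε hε
  obtain ⟨δ₁, hδ₁, h1⟩ := h3a Nf hNf reg hMS ε hε
  obtain ⟨δ', hδ', -, h2⟩ := h3b Nf hNf reg hMS ε hε δ₁ hδ₁
  refine ⟨δ', hδ', fun M hU hB m hm => ?_⟩
  exact h2 M hB (h1 M hB hU) m hm

/-! ## §3 The crux BY NAME (through the landed split glue p140732) -/

/-- **The crux from the four stubs**: child 3 by §2, then
`Theorems.RobustYangMillsHandover.Split.RobustYangMillsHandover_of_subs` (landed, definition-free order theory on `ℝ`
+ `m_crit`-shift pin).  Sorries only inside `stub_*`. -/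
theorem RobustYangMillsHandover_of : Summit.QuantumFields.QCD.Theses.HeatSlicedQuarks.RobustYangMillsHandover :=
  Summit.QuantumFields.QCD.Theorems.RobustYangMillsHandover.Split.RobustYangMillsHandover_of_subs
    stub_heavyThresholdHandover stub_gaplessPointOnMassAxis
    (gappedMassContinuation_of stub_anchoredGapContinuation stub_anchoredDataContinuation)

/-! ## §4 Sanity: the anchored forms are not weaker than needed and not the crux reworded -/

/- Sanity (an `example`, so that the file has no orphan declaration): s1's child 3 ⇒ 3b with `δ' := min δ δ₃` — 3b is a
genuine WEAKENING of child 3 (it is handed the lattice rate on the target region); 3a is lattice-only and neither implies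
nor is implied by child 3 on its own (3a keeps the rate `ε/2`; child 3 continues the body at SOME rate). -/
example
    (h3 : ∀ Nf : ℕ, Nf = 2 ∨ Nf = 3 → ∀ reg : Literature.MathematicalPhysics.QuantumFieldTheory.QCDRegularisation Nf, reg.HasMassScaling → ∀ ε : ℝ, 0 < ε → ∃ δ : ℝ, 0 < δ ∧ ∀ M : ℝ, (∀ m : Fin Nf → ℝ, (∀ f, M < m f) → (reg.scheme m 0 0).HasLatticeMassGap ε) → (∀ m : Fin Nf → ℝ, (∀ f, M < m f) → ∃ (z shift : Literature.MathematicalPhysics.QuantumFieldTheory.QCDField Nf → ℕ → ℝ) (T : Literature.MathematicalPhysics.QuantumFieldTheory.OSData (Literature.MathematicalPhysics.QuantumFieldTheory.QCDField Nf) 4), Literature.MathematicalPhysics.QuantumFieldTheory.IsQCDAlong (reg.scheme m z shift) T ∧ T.IsNontrivial Literature.MathematicalPhysics.QuantumFieldTheory.QCDField.glue ∧ T.IsNonGaussian Literature.MathematicalPhysics.QuantumFieldTheory.QCDField.glue ∧ (∀ f g : Fin Nf, f ≠ g → T.IsNontrivial (Literature.MathematicalPhysics.QuantumFieldTheory.QCDField.pseudoRe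 f g)) ∧ ∃ Δ > 0, T.HasMassGap Δ ∧ (reg.scheme m z shift).HasLatticeMassGap Δ) → ∀ m : Fin Nf → ℝ, (∀ f, M - δ < m f) → ∃ (z shift : Literature.MathematicalPhysics.QuantumFieldTheory.QCDField Nf → ℕ → ℝ) (T : Literature.MathematicalPhysics.QuantumFieldTheory.OSData (Literature.MathematicalPhysics.QuantumFieldTheory.QCDField Nf) 4), Literature.MathematicalPhysics.QuantumFieldTheory.IsQCDAlong (reg.scheme m z shift) T ∧ T.IsNontrivial Literature.MathematicalPhysics.QuantumFieldTheory.QCDField.glue ∧ T.IsNonGaussian Literature.MathematicalPhysics.QuantumFieldTheory.QCDField.glue ∧ (∀ f g : Fin Nf, f ≠ g → T.IsNontrivial (Literature.MathematicalPhysics.QuantumFieldTheory.QCDField.pseudoRe f g)) ∧ ∃ Δ > 0, T.HasMassGap Δ ∧ (reg.scheme m z shift).HasLatticeMassGap Δ) :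
    ∀ Nf : ℕ, Nf = 2 ∨ Nf = 3 → ∀ reg : Literature.MathematicalPhysics.QuantumFieldTheory.QCDRegularisation Nf, reg.HasMassScaling → ∀ ε : ℝ, 0 < ε → ∀ δ : ℝ, 0 < δ → ∃ δ' : ℝ, 0 < δ' ∧ δ' ≤ δ ∧ ∀ M : ℝ, (∀ m : Fin Nf → ℝ, (∀ f, M < m f) → ∃ (z shift : Literature.MathematicalPhysics.QuantumFieldTheory.QCDField Nf → ℕ → ℝ) (T : Literature.MathematicalPhysics.QuantumFieldTheory.OSData (Literature.MathematicalPhysics.QuantumFieldTheory.QCDField Nf) 4), Literature.MathematicalPhysics.QuantumFieldTheory.IsQCDAlong (reg.scheme m z shift) T ∧ T.IsNontrivial Literature.MathematicalPhysics.QuantumFieldTheory.QCDField.glue ∧ T.IsNonGaussian Literature.MathematicalPhysics.QuantumFieldTheory.QCDField.glue ∧ (∀ f g : Fin Nf, f ≠ g → T.IsNontrivial (Literature.MathematicalPhysics.QuantumFieldTheory.QCDField.pseudoRe f g)) ∧ ∃ Δ > 0, T.HasMassGap Δ ∧ (reg.scheme m z shift).HasLatticeMassGap Δ) → (∀ m :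 Fin Nf → ℝ, (∀ f, M - δ < m f) → (reg.scheme m 0 0).HasLatticeMassGap (ε / 2)) → ∀ m : Fin Nf → ℝ, (∀ f, M - δ' < m f) → ∃ (z shift : Literature.MathematicalPhysics.QuantumFieldTheory.QCDField Nf → ℕ → ℝ) (T : Literature.MathematicalPhysics.QuantumFieldTheory.OSData (Literature.MathematicalPhysics.QuantumFieldTheory.QCDField Nf) 4), Literature.MathematicalPhysics.QuantumFieldTheory.IsQCDAlong (reg.scheme m z shift) T ∧ T.IsNontrivial Literature.MathematicalPhysics.QuantumFieldTheory.QCDField.glue ∧ T.IsNonGaussian Literature.MathematicalPhysics.QuantumFieldTheory.QCDField.glue ∧ (∀ f g : Fin Nf, f ≠ g → T.IsNontrivial (Literature.MathematicalPhysics.QuantumFieldTheory.QCDField.pseudoRe f g)) ∧ ∃ Δ > 0, T.HasMassGap Δ ∧ (reg.scheme m z shift).HasLatticeMassGap Δ := by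
  intro Nf hNf reg hMS ε hε δ hδ
  obtain ⟨δ₃, hδ₃, h⟩ := h3 Nf hNf reg hMS (ε / 2) (by positivity)
  refine ⟨min δ δ₃, lt_min hδ hδ₃, min_le_left _ _, fun M hB hU m hm => ?_⟩
  -- apply child 3 at the anchor `M` with rate `ε/2` (available above `M ⊆` above `M − δ`)
  have hU' : ∀ m : Fin Nf → ℝ, (∀ f, M < m f) → (reg.scheme m 0 0).HasLatticeMassGap (ε / 2) :=
    fun m hm' => hU m fun f => by linarith [hm' f]
  exact h M hU' hB m fun f => lt_of_le_of_lt (by linarith [min_le_right δ δ₃]) (hm f)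

end Summit.QuantumFields.QCD.Cruxes.RobustYangMillsHandover.GlimmJaffeContinuation
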